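import Literature.AlgebraicGeometry.HodgeTheory.MonodromyWeightFiltrationSl2
import Literature.AlgebraicGeometry.Motives.HodgeTensorProofs
import HarnessLib

/-!
# The monodromy weight filtration of a tensor product (Deligne, Weil II, Prop. (1.6.9) (i))

Topic `Literature/AlgebraicGeometry/HodgeTheory` (namespace `Literature.AlgebraicGeometry.HodgeTheory`). The tensor
product clause of Deligne's compatibilities of the monodromy weight filtration `M = W(N)` (the tree's
`IsMonodromyWeightFiltration N c W` of `MonodromyWeightFiltration.lean`: an increasing finite filtration with (1)
`N W_i ⊂ W_{i−2}` and (2) `N^ℓ : Gr_{c+ℓ} ⥲ Gr_{c−ℓ}`, centred at `c`; uniqueness proved there; direct sums and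
duals = (1.6.7), (1.6.9) (ii) in `MonodromyWeightFiltrationSumDual.lean`, whose header leaves «`-- TODO(general
form)`: (1.6.9) (i) (tensor products, characteristic `0`)»). THEOREMS ONLY (no definition, no instance, no named
fact; net debt `0`).

PRINTED RESULTS (P. Deligne, *La conjecture de Weil. II*, Publ. Math. IHÉS 52 (1980), §(1.6) «Autour de
Jacobson–Morosov»; held text `paper:doi-10-1007-bf02684780`, p0032), VERBATIM:
* (1.6.8) «Si `k` est de caractéristique `0`, on peut interpréter la filtration `M` en terme du théorème de
  Jacobson-Morosov : si `u : SL(2) → GL(V)` satisfait `du(0 0; 1 0) = N`, et que `V_j` est le sous-espace de `V`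
  formé des vecteurs `v` tels que `u(t 0; 0 t⁻¹) v = t^j v`, alors `M_i` est la somme des `V_j` pour `j ≤ i`. …
  Cette interprétation de `M` donne son comportement par produit tensoriel et passage au dual.»
* PROPOSITION (1.6.9). «Définissons le produit tensoriel `(V, N)` de `(V′, N′)` et `(V″, N″)` par `V = V′ ⊗ V″`,
  `N = N′ ⊗ 1 + 1 ⊗ N″` … (i) Si `k` est de caractéristique `0`, la filtration `M` d'un produit tensoriel est le
  produit tensoriel des filtrations `M` des facteurs (`M_i(V′ ⊗ V″) = Σ_{i′+i″=i} M_{i′}(V′) ⊗ M_{i″}(V″)`).»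

THIS FILE (all proved; `k` a field of characteristic `0`, `V₁`, `V₂` finite-dimensional; the tensor filtration is
written exactly as the tree's `MixedHodgeStructure.tensorW`: `n ↦ ⨆_{i+j=n} W₁ i ⊗ W₂ j` with
`A ⊗ B = Submodule.map₂ (TensorProduct.mk k V₁ V₂) A B`, and the Kronecker sum as
`TensorProduct.map N₁ 1 + TensorProduct.map 1 N₂`):
* §0 Kronecker sums (any commutative ring): `kroneckerSum_commutator`
  (`[A₁⊗1 + 1⊗A₂, B₁⊗1 + 1⊗B₂] = [A₁,B₁]⊗1 + 1⊗[A₂,B₂]`), hence **the tensor product of two `𝔰𝔩₂`-triples of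
  endomorphisms `(Y₁, E₁, N₁)`, `(Y₂, E₂, N₂)` is the `𝔰𝔩₂`-triple `(Y₁⊗1+1⊗Y₂, E₁⊗1+1⊗E₂, N₁⊗1+1⊗N₂)`**
  (`kroneckerSum_sl2_he`, `_hf`, `_ef` — Deligne's «`u′ ⊗ u″`»), and `isNilpotent_kroneckerSum`.
* §1 eigenspaces of a Kronecker sum: if `Y₁`, `Y₂` are diagonalisable with integer eigenvalues then
  **`E_j(Y₁⊗1+1⊗Y₂) = Σ_{a+b=j} E_a(Y₁) ⊗ E_b(Y₂)`** (`eigenspace_kroneckerSum_eq`; Deligne's «`V_j`» of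
  `u′ ⊗ u″`), through the lattice lemma `le_of_iSup_eq_top_of_iSupIndep` and the tree's
  `HodgeStructure.iSupIndep_map₂_mk` / `iSup_map₂_mk_eq_top`.
* §2 (A.3.4) without the proviso `Y ≠ 0`: `isMonodromyWeightFiltration_of_sl2'` (the degenerate triple `(0,0,0)`
  gives the one-step filtration), and `exists_sl2Triple_iSup_eigenspace_eq_top` (Jacobson–Morozov through any
  nilpotent `N`, `N = 0` included, with `Σ_{j ∈ ℤ} E_j(Y) = V`).
* §3 **PROPOSITION (1.6.9) (i)**: `IsMonodromyWeightFiltration.tensor` — if `W₁` is the monodromy weight filtration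
  of `N₁` centred at `c₁` and `W₂` that of `N₂` centred at `c₂`, then `n ↦ Σ_{i+j=n} W₁ i ⊗ W₂ j` is the monodromy
  weight filtration of `N₁⊗1 + 1⊗N₂` centred at `c₁ + c₂`; by uniqueness `IsMonodromyWeightFiltration.eq_tensor`
  («la filtration `M` d'un produit tensoriel est le produit tensoriel des filtrations `M` des facteurs»), and for the
  tree's definition `monodromyWeightFiltration_kroneckerSum`.

## Proof notes

Deligne's proof, followed: the filtration of each factor is `Σ_{j ≤ i−c} E_j(Y)` for an `SL(2)` = `𝔰𝔩₂`-triple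
through `N` ((1.6.8) = the tree's (A.3.4) `IsMonodromyWeightFiltration.eq_biSup_eigenspace_of_sl2` with
Jacobson–Morozov `exists_sl2Triple_of_isNilpotent'`); the tensor product representation `u′ ⊗ u″` has
`d(u′⊗u″) = N′⊗1 + 1⊗N″` and weight spaces `V_j = Σ_{a+b=j} V′_a ⊗ V″_b`, so (A.3.4) for the tensor triple and
the reindexing `Σ_{i′+i″=i} (Σ_{a ≤ i′−c′} ⊗ Σ_{b ≤ i″−c″}) = Σ_{a+b ≤ i−c′−c″} = Σ_{j ≤ i−c} Σ_{a+b=j}` give (i).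
Characteristic `0` enters through Jacobson–Morozov and the integrality/independence of the weights.
`-- TODO(general form)`: (1.6.9) (iii) (`Gr^M` of a tensor product) is not spelled out here; the mixed-Hodge
version is the tree's `Motives/MixedHodgeStructureTensorGr.lean`.

## References

* [Deligne1980] P. Deligne, *La conjecture de Weil. II*, Publ. Math. IHÉS 52 (1980) 137–252: (1.6.8),
  Prop. (1.6.9) (i) (held text p0032).
* [CattaniElZeinGriffithsLe2014] E. Cattani et al. (eds.), *Hodge Theory* (2014), App. A (A.3.4), Exerc. A.3.6.
-/

namespace Literature.AlgebraicGeometry.HodgeTheory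

open Module Literature.Algebra.Lie
open Literature.AlgebraicGeometry.Motives.HodgeStructure (iSupIndep_map₂_mk iSup_map₂_mk_eq_top)

universe u w w'

/-! ## §0 Kronecker sums of endomorphisms -/

section KroneckerSum

variable {R : Type u} [CommRing R] {V₁ : Type w} [AddCommGroup V₁] [Module R V₁] {V₂ : Type w'} [AddCommGroup V₂]
  [Module R V₂]

/-- `(A₁ ⊗ 1)(1 ⊗ A₂) = A₁ ⊗ A₂`. [folklore] -/
private theorem map_one_mul_one_map (A₁ : Module.End R V₁) (A₂ : Module.End R V₂) :
    TensorProduct.map A₁ (1 : Module.End R V₂) * TensorProduct.map (1 : Module.End R V₁) A₂ =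
      TensorProduct.map A₁ A₂ := by
  rw [← TensorProduct.map_mul, mul_one, one_mul]

/-- `(1 ⊗ A₂)(A₁ ⊗ 1) = A₁ ⊗ A₂`. [folklore] -/
private theorem one_map_mul_map_one (A₁ : Module.End R V₁) (A₂ : Module.End R V₂) :
    TensorProduct.map (1 : Module.End R V₁) A₂ * TensorProduct.map A₁ (1 : Module.End R V₂) =
      TensorProduct.map A₁ A₂ := by
  rw [← TensorProduct.map_mul, mul_one, one_mul]

/-- `A₁ ⊗ 1` and `1 ⊗ A₂` commute. [folklore] -/
private theorem commute_map_one_one_map (A₁ : Module.End R V₁) (A₂ : Module.End R V₂) :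
    Commute (TensorProduct.map A₁ (1 : Module.End R V₂)) (TensorProduct.map (1 : Module.End R V₁) A₂) := by
  rw [Commute, SemiconjBy, map_one_mul_one_map, one_map_mul_map_one]

/-- **The commutator of two Kronecker sums**: `[A₁⊗1 + 1⊗A₂, B₁⊗1 + 1⊗B₂] = [A₁,B₁]⊗1 + 1⊗[A₂,B₂]` (the mixed
terms `(A₁⊗1)(1⊗B₂) = A₁⊗B₂ = (1⊗B₂)(A₁⊗1)` cancel). [folklore] -/
private theorem kroneckerSum_commutator (A₁ B₁ : Module.End R V₁) (A₂ B₂ : Module.End R V₂) :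
    (TensorProduct.map A₁ (1 : Module.End R V₂) + TensorProduct.map (1 : Module.End R V₁) A₂) *
        (TensorProduct.map B₁ (1 : Module.End R V₂) + TensorProduct.map (1 : Module.End R V₁) B₂) -
      (TensorProduct.map B₁ (1 : Module.End R V₂) + TensorProduct.map (1 : Module.End R V₁) B₂) *
        (TensorProduct.map A₁ (1 : Module.End R V₂) + TensorProduct.map (1 : Module.End R V₁) A₂) =
      TensorProduct.map (A₁ * B₁ - B₁ * A₁) (1 : Module.End R V₂) +
        TensorProduct.map (1 : Module.End R V₁) (A₂ * B₂ - B₂ * A₂) := by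
  apply TensorProduct.ext'
  intro x y
  simp only [LinearMap.sub_apply, LinearMap.add_apply, Module.End.mul_apply, TensorProduct.map_tmul,
    Module.End.one_apply, map_add, TensorProduct.sub_tmul, TensorProduct.tmul_sub]
  abel

/-- `(c • A₁) ⊗ 1 = c • (A₁ ⊗ 1)`, as a special case of `(c • f) ⊗ g = c • (f ⊗ g)`. [folklore] -/
private theorem map_smul_left' (c : R) (A₁ : Module.End R V₁) (A₂ : Module.End R V₂) :
    TensorProduct.map (c • A₁) A₂ = c • TensorProduct.map A₁ A₂ := by
  apply TensorProduct.ext'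
  intro x y
  simp only [TensorProduct.map_tmul, LinearMap.smul_apply, TensorProduct.smul_tmul']

/-- `f ⊗ (c • g) = c • (f ⊗ g)`. [folklore] -/
private theorem map_smul_right' (c : R) (A₁ : Module.End R V₁) (A₂ : Module.End R V₂) :
    TensorProduct.map A₁ (c • A₂) = c • TensorProduct.map A₁ A₂ := by
  apply TensorProduct.ext'
  intro x y
  simp only [TensorProduct.map_tmul, LinearMap.smul_apply, TensorProduct.tmul_smul]

/-- `(-f) ⊗ g = -(f ⊗ g)`. [folklore] -/
private theorem map_neg_left' (A₁ : Module.End R V₁) (A₂ : Module.End R V₂) :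
    TensorProduct.map (-A₁) A₂ = -TensorProduct.map A₁ A₂ := by
  apply TensorProduct.ext'
  intro x y
  simp only [TensorProduct.map_tmul, LinearMap.neg_apply, TensorProduct.neg_tmul]

/-- `f ⊗ (-g) = -(f ⊗ g)`. [folklore] -/
private theorem map_neg_right' (A₁ : Module.End R V₁) (A₂ : Module.End R V₂) :
    TensorProduct.map A₁ (-A₂) = -TensorProduct.map A₁ A₂ := by
  apply TensorProduct.ext'
  intro x y
  simp only [TensorProduct.map_tmul, LinearMap.neg_apply, TensorProduct.tmul_neg]

/-- **The tensor product of two `𝔰𝔩₂`-triples, `[H, E] = 2E`**: if `[Y₁, E₁] = 2E₁` and `[Y₂, E₂] = 2E₂` then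
`[Y₁⊗1+1⊗Y₂, E₁⊗1+1⊗E₂] = 2(E₁⊗1+1⊗E₂)` (Deligne's representation `u′ ⊗ u″` of `SL(2)`, infinitesimally).
[cite: Deligne1980, (1.6.8)–(1.6.9) (p0032)] -/
theorem kroneckerSum_sl2_he {Y₁ E₁ : Module.End R V₁} {Y₂ E₂ : Module.End R V₂}
    (h₁ : Y₁ * E₁ - E₁ * Y₁ = (2 : R) • E₁) (h₂ : Y₂ * E₂ - E₂ * Y₂ = (2 : R) • E₂) :
    (TensorProduct.map Y₁ (1 : Module.End R V₂) + TensorProduct.map (1 : Module.End R V₁) Y₂) *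
        (TensorProduct.map E₁ (1 : Module.End R V₂) + TensorProduct.map (1 : Module.End R V₁) E₂) -
      (TensorProduct.map E₁ (1 : Module.End R V₂) + TensorProduct.map (1 : Module.End R V₁) E₂) *
        (TensorProduct.map Y₁ (1 : Module.End R V₂) + TensorProduct.map (1 : Module.End R V₁) Y₂) =
      (2 : R) • (TensorProduct.map E₁ (1 : Module.End R V₂) + TensorProduct.map (1 : Module.End R V₁) E₂) := by
  rw [kroneckerSum_commutator, h₁, h₂, map_smul_left', map_smul_right', smul_add]

/-- **The tensor product of two `𝔰𝔩₂`-triples, `[H, F] = −2F`**: `[Y₁⊗1+1⊗Y₂, N₁⊗1+1⊗N₂] = −2(N₁⊗1+1⊗N₂)`.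
[cite: Deligne1980, (1.6.8)–(1.6.9) (p0032)] -/
theorem kroneckerSum_sl2_hf {Y₁ N₁ : Module.End R V₁} {Y₂ N₂ : Module.End R V₂}
    (h₁ : Y₁ * N₁ - N₁ * Y₁ = -((2 : R) • N₁)) (h₂ : Y₂ * N₂ - N₂ * Y₂ = -((2 : R) • N₂)) :
    (TensorProduct.map Y₁ (1 : Module.End R V₂) + TensorProduct.map (1 : Module.End R V₁) Y₂) *
        (TensorProduct.map N₁ (1 : Module.End R V₂) + TensorProduct.map (1 : Module.End R V₁) N₂) -
      (TensorProduct.map N₁ (1 : Module.End R V₂) + TensorProduct.map (1 : Module.End R V₁) N₂) *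
        (TensorProduct.map Y₁ (1 : Module.End R V₂) + TensorProduct.map (1 : Module.End R V₁) Y₂) =
      -((2 : R) • (TensorProduct.map N₁ (1 : Module.End R V₂) + TensorProduct.map (1 : Module.End R V₁) N₂)) := by
  rw [kroneckerSum_commutator, h₁, h₂, map_neg_left', map_neg_right', map_smul_left', map_smul_right', smul_add,
    neg_add]

/-- **The tensor product of two `𝔰𝔩₂`-triples, `[E, F] = H`**: `[E₁⊗1+1⊗E₂, N₁⊗1+1⊗N₂] = Y₁⊗1+1⊗Y₂`; so
`N = N′⊗1 + 1⊗N″` is the nil-negative element of the tensor triple («`du(0 0; 1 0) = N`» for `u = u′ ⊗ u″`).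
[cite: Deligne1980, (1.6.8)–(1.6.9) (p0032)] -/
theorem kroneckerSum_sl2_ef {Y₁ E₁ N₁ : Module.End R V₁} {Y₂ E₂ N₂ : Module.End R V₂}
    (h₁ : E₁ * N₁ - N₁ * E₁ = Y₁) (h₂ : E₂ * N₂ - N₂ * E₂ = Y₂) :
    (TensorProduct.map E₁ (1 : Module.End R V₂) + TensorProduct.map (1 : Module.End R V₁) E₂) *
        (TensorProduct.map N₁ (1 : Module.End R V₂) + TensorProduct.map (1 : Module.End R V₁) N₂) -
      (TensorProduct.map N₁ (1 : Module.End R V₂) + TensorProduct.map (1 : Module.End R V₁) N₂) *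
        (TensorProduct.map E₁ (1 : Module.End R V₂) + TensorProduct.map (1 : Module.End R V₁) E₂) =
      TensorProduct.map Y₁ (1 : Module.End R V₂) + TensorProduct.map (1 : Module.End R V₁) Y₂ := by
  rw [kroneckerSum_commutator, h₁, h₂]

/-- `(N₁ ⊗ 1)^m = N₁^m ⊗ 1`, so `N₁ ⊗ 1` is nilpotent when `N₁` is. [folklore] -/
private theorem isNilpotent_map_one {N₁ : Module.End R V₁} (h₁ : IsNilpotent N₁) :
    IsNilpotent (TensorProduct.map N₁ (1 : Module.End R V₂)) := by
  obtain ⟨m, hm⟩ := h₁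
  exact ⟨m, by rw [TensorProduct.map_pow, hm, TensorProduct.map_zero_left]⟩

/-- `(1 ⊗ N₂)^m = 1 ⊗ N₂^m`, so `1 ⊗ N₂` is nilpotent when `N₂` is. [folklore] -/
private theorem isNilpotent_one_map {N₂ : Module.End R V₂} (h₂ : IsNilpotent N₂) :
    IsNilpotent (TensorProduct.map (1 : Module.End R V₁) N₂) := by
  obtain ⟨m, hm⟩ := h₂
  exact ⟨m, by rw [TensorProduct.map_pow, hm, TensorProduct.map_zero_right]⟩

/-- **`N = N′⊗1 + 1⊗N″` is nilpotent** (a sum of two commuting nilpotents).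
[cite: Deligne1980, Prop. (1.6.9) (p0032)] -/
theorem isNilpotent_kroneckerSum {N₁ : Module.End R V₁} {N₂ : Module.End R V₂} (h₁ : IsNilpotent N₁)
    (h₂ : IsNilpotent N₂) :
    IsNilpotent (TensorProduct.map N₁ (1 : Module.End R V₂) + TensorProduct.map (1 : Module.End R V₁) N₂) :=
  (commute_map_one_one_map N₁ N₂).isNilpotent_add (isNilpotent_map_one h₁) (isNilpotent_one_map h₂)

/-- `E_a(Y₁) ⊗ E_b(Y₂) ⊆ E_{a+b}(Y₁⊗1 + 1⊗Y₂)`. [folklore] -/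
private theorem map₂_eigenspace_le_eigenspace_kroneckerSum (Y₁ : Module.End R V₁) (Y₂ : Module.End R V₂)
    (a b : R) :
    Submodule.map₂ (TensorProduct.mk R V₁ V₂) (Y₁.eigenspace a) (Y₂.eigenspace b) ≤
      Module.End.eigenspace
        (TensorProduct.map Y₁ (1 : Module.End R V₂) + TensorProduct.map (1 : Module.End R V₁) Y₂) (a + b) := by
  refine Submodule.map₂_le.2 fun x hx y hy => ?_
  rw [Module.End.mem_eigenspace_iff] at hx hy ⊢
  rw [TensorProduct.mk_apply, LinearMap.add_apply, TensorProduct.map_tmul, TensorProduct.map_tmul,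
    Module.End.one_apply, Module.End.one_apply, hx, hy, ← TensorProduct.smul_tmul', TensorProduct.tmul_smul,
    add_smul]

end KroneckerSum

/-! ## §1 Eigenspaces of a Kronecker sum of diagonalisable endomorphisms with integer eigenvalues -/

section Lattice

variable {R : Type u} [Ring R] {M : Type w} [AddCommGroup M] [Module R M] {ι : Type w'}

/-- **Comparison of two decompositions**: if `M = Σ_i Q_i`, the family `(E_i)` is independent and `Q_i ⊆ E_i` for
every `i`, then `E_i ⊆ Q_i` (so `Q_i = E_i`): for `x ∈ E_i` write `x = q + r`, `q ∈ Q_i`, `r ∈ Σ_{j≠i} Q_j`; then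
`r = x − q ∈ E_i ∩ Σ_{j≠i} E_j = 0`. [folklore] -/
private theorem le_of_iSup_eq_top_of_iSupIndep {Q E : ι → Submodule R M} (hQ : ⨆ i, Q i = ⊤) (hE : iSupIndep E)
    (hle : ∀ i, Q i ≤ E i) (i : ι) : E i ≤ Q i := by
  intro x hx
  have hx' : x ∈ Q i ⊔ ⨆ (j) (_ : j ≠ i), Q j := by
    rw [← iSup_split_single Q i, hQ]
    exact Submodule.mem_top
  obtain ⟨q, hq, r, hr, rfl⟩ := Submodule.mem_sup.1 hx'
  have hrE : r ∈ E i := by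
    have h := (E i).sub_mem hx (hle i hq)
    rwa [add_sub_cancel_left] at h
  have hr' : r ∈ ⨆ (j) (_ : j ≠ i), E j := (iSup₂_mono fun j _ => hle j) hr
  have hr0 : r = 0 := (Submodule.disjoint_def.1 (hE i)) r hrE hr'
  rw [hr0, add_zero]
  exact hq

/-- Under the hypotheses of `le_of_iSup_eq_top_of_iSupIndep`, `Q_i = E_i`. [folklore] -/
private theorem eq_of_iSup_eq_top_of_iSupIndep {Q E : ι → Submodule R M} (hQ : ⨆ i, Q i = ⊤) (hE : iSupIndep E)
    (hle : ∀ i, Q i ≤ E i) (i : ι) : Q i = E i :=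
  le_antisymm (hle i) (le_of_iSup_eq_top_of_iSupIndep hQ hE hle i)

end Lattice

section Eigenspaces

variable {k : Type u} [Field k] [CharZero k] {V₁ : Type w} [AddCommGroup V₁] [Module k V₁] {V₂ : Type w'}
  [AddCommGroup V₂] [Module k V₂]

/-- The integer eigenspaces `(E_a(Y))_{a ∈ ℤ}` of an endomorphism are independent (characteristic `0`: `ℤ → k` is
injective). [folklore] -/
private theorem iSupIndep_eigenspace_intCast {V : Type w} [AddCommGroup V] [Module k V] (Y : Module.End k V) :
    iSupIndep fun a : ℤ => Y.eigenspace (a : k) :=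
  Y.eigenspaces_iSupIndep.comp Int.cast_injective

omit [CharZero k] in
/-- Regrouping a `ℤ × ℤ`-indexed supremum by the sum of the indices. [folklore] -/
private theorem iSup_fiber_add_eq {M : Type w} [AddCommGroup M] [Module k M] (P : ℤ × ℤ → Submodule k M) :
    ⨆ j : ℤ, ⨆ ab ∈ {ab : ℤ × ℤ | ab.1 + ab.2 = j}, P ab = ⨆ ab, P ab :=
  le_antisymm (iSup_le fun _ => iSup₂_le fun ab _ => le_iSup P ab)
    (iSup_le fun ab => le_iSup_of_le (ab.1 + ab.2) (le_iSup₂_of_le ab rfl le_rfl))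

/-- **The weight spaces of a tensor product**: if `V₁ = Σ_{a ∈ ℤ} E_a(Y₁)` and `V₂ = Σ_{b ∈ ℤ} E_b(Y₂)`, then
`E_j(Y₁⊗1 + 1⊗Y₂) = Σ_{a+b=j} E_a(Y₁) ⊗ E_b(Y₂)` for every `j ∈ ℤ` (Deligne: the `V_j` of `u′ ⊗ u″`; the
`E_a(Y₁) ⊗ E_b(Y₂)` form a direct-sum decomposition of `V₁ ⊗ V₂` refining the independent family of eigenspaces
of the Kronecker sum). [cite: Deligne1980, (1.6.8)–(1.6.9) (p0032)] -/
theorem eigenspace_kroneckerSum_eq {Y₁ : Module.End k V₁} {Y₂ : Module.End k V₂}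
    (h₁ : ⨆ a : ℤ, Y₁.eigenspace (a : k) = ⊤) (h₂ : ⨆ b : ℤ, Y₂.eigenspace (b : k) = ⊤) (j : ℤ) :
    Module.End.eigenspace
        (TensorProduct.map Y₁ (1 : Module.End k V₂) + TensorProduct.map (1 : Module.End k V₁) Y₂) (j : k) =
      ⨆ ab ∈ {ab : ℤ × ℤ | ab.1 + ab.2 = j},
        Submodule.map₂ (TensorProduct.mk k V₁ V₂) (Y₁.eigenspace (ab.1 : k)) (Y₂.eigenspace (ab.2 : k)) := by
  have hPtop : ⨆ ab : ℤ × ℤ, Submodule.map₂ (TensorProduct.mk k V₁ V₂) (Y₁.eigenspace (ab.1 : k))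
      (Y₂.eigenspace (ab.2 : k)) = ⊤ :=
    iSup_map₂_mk_eq_top (𝒜 := fun a : ℤ => Y₁.eigenspace (a : k)) (ℬ := fun b : ℤ => Y₂.eigenspace (b : k)) h₁ h₂
  have hQtop : ⨆ j : ℤ, ⨆ ab ∈ {ab : ℤ × ℤ | ab.1 + ab.2 = j}, Submodule.map₂ (TensorProduct.mk k V₁ V₂)
      (Y₁.eigenspace (ab.1 : k)) (Y₂.eigenspace (ab.2 : k)) = ⊤ := by
    rw [iSup_fiber_add_eq, hPtop]
  have hle : ∀ j : ℤ, ⨆ ab ∈ {ab : ℤ × ℤ | ab.1 + ab.2 = j}, Submodule.map₂ (TensorProduct.mk k V₁ V₂)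
      (Y₁.eigenspace (ab.1 : k)) (Y₂.eigenspace (ab.2 : k)) ≤
      Module.End.eigenspace
        (TensorProduct.map Y₁ (1 : Module.End k V₂) + TensorProduct.map (1 : Module.End k V₁) Y₂) (j : k) :=
    fun j =>
    iSup₂_le fun ab (hab : ab.1 + ab.2 = j) => by
      have h := map₂_eigenspace_le_eigenspace_kroneckerSum Y₁ Y₂ (ab.1 : k) (ab.2 : k)
      rw [← Int.cast_add, hab] at h
      exact h
  exact (eq_of_iSup_eq_top_of_iSupIndep hQtop
    (iSupIndep_eigenspace_intCast
      (TensorProduct.map Y₁ (1 : Module.End k V₂) + TensorProduct.map (1 : Module.End k V₁) Y₂)) hle j).symm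

end Eigenspaces

/-! ## §2 (A.3.4) for possibly degenerate triples; Jacobson–Morozov with complete integer weights -/

section Sl2

variable {k : Type u} [Field k] [CharZero k] {V : Type w} [AddCommGroup V] [Module k V] [FiniteDimensional k V]

omit [FiniteDimensional k V] in
/-- The integer eigenspaces of the zero endomorphism: `E_0(0) = V`, `E_j(0) = 0` for `j ≠ 0`. [folklore] -/
private theorem eigenspace_zero_intCast (j : ℤ) :
    (0 : Module.End k V).eigenspace (j : k) = if j = 0 then ⊤ else ⊥ := by
  split_ifs with hj
  · rw [hj, Int.cast_zero, Module.End.eigenspace_zero, LinearMap.ker_zero]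
  · refine (Submodule.eq_bot_iff _).2 fun x hx => ?_
    rw [Module.End.mem_eigenspace_iff, LinearMap.zero_apply, eq_comm, smul_eq_zero] at hx
    exact hx.resolve_left (Int.cast_ne_zero.2 hj)

omit [FiniteDimensional k V] in
/-- For the zero endomorphism `Σ_{j ≤ m} E_j(0)` is `V` if `0 ≤ m` and `0` otherwise — the one-step filtration.
[folklore] -/
private theorem biSup_eigenspace_zero_intCast_eq_stepFiltration (c : ℤ) :
    (fun i => ⨆ (j : ℤ) (_ : j ≤ i - c), (0 : Module.End k V).eigenspace (j : k)) = stepFiltration c := by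
  funext i
  by_cases hi : i < c
  · rw [stepFiltration_of_lt k V hi]
    refine (Submodule.eq_bot_iff _).2 fun x hx => ?_
    have h : (⨆ (j : ℤ) (_ : j ≤ i - c), (0 : Module.End k V).eigenspace (j : k)) = ⊥ :=
      iSup₂_eq_bot.2 fun j hj => by
        rw [eigenspace_zero_intCast, if_neg (by omega)]
    rw [h] at hx
    exact hx
  · rw [stepFiltration_of_le k V (not_lt.1 hi)]
    refine top_unique (le_iSup₂_of_le (f := fun (j : ℤ) (_ : j ≤ i - c) => (0 : Module.End k V).eigenspace (j : k))
      0 (by omega) ?_)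
    rw [eigenspace_zero_intCast, if_pos rfl]

/-- **(A.3.4) for a possibly degenerate `𝔰𝔩₂`-triple**: if `(Y, E, N)` satisfy `[Y, E] = 2E`, `[Y, N] = −2N`,
`[E, N] = Y` (no proviso `Y ≠ 0`: in characteristic `0`, `Y = 0` forces `N = 0`), then `W_i = Σ_{j ≤ i−c} E_j(Y)` is
the monodromy weight filtration of `N` centred at `c`. [cite: CattaniElZeinGriffithsLe2014, App. A (A.3.4) (p0061)]
[cite: Deligne1980, (1.6.8) (p0032)] -/
theorem isMonodromyWeightFiltration_of_sl2' {Y E N : Module.End k V} (hYE : Y * E - E * Y = (2 : k) • E)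
    (hYN : Y * N - N * Y = -((2 : k) • N)) (hEN : E * N - N * E = Y) (c : ℤ) :
    IsMonodromyWeightFiltration N c (fun i => ⨆ (j : ℤ) (_ : j ≤ i - c), Y.eigenspace (j : k)) := by
  by_cases hY : Y = 0
  · have hN : N = 0 := by
      rw [hY, zero_mul, mul_zero, sub_zero, eq_comm, neg_eq_zero, smul_eq_zero] at hYN
      exact hYN.resolve_left two_ne_zero
    rw [hY, hN, biSup_eigenspace_zero_intCast_eq_stepFiltration]
    exact isMonodromyWeightFiltration_zero k V c
  · exact isMonodromyWeightFiltration_of_sl2 hY hYE hYN hEN c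

/-- **Jacobson–Morozov with complete integer weights**: every nilpotent endomorphism `N` of a finite-dimensional
vector space in characteristic `0` (including `N = 0`, with the degenerate triple `(0, 0, 0)`) lies in a triple
`(Y, E, N)` with `[Y, E] = 2E`, `[Y, N] = −2N`, `[E, N] = Y` and `V = Σ_{j ∈ ℤ} E_j(Y)` («si `u : SL(2) → GL(V)`
satisfait `du(0 0; 1 0) = N` … `V_j`»). [cite: Deligne1980, (1.6.8) (p0032)]
[cite: CattaniElZeinGriffithsLe2014, App. A Exerc. A.3.6 (p0061)] -/
theorem exists_sl2Triple_iSup_eigenspace_eq_top (N : Module.End k V) (hN : IsNilpotent N) :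
    ∃ Y E : Module.End k V, Y * E - E * Y = (2 : k) • E ∧ Y * N - N * Y = -((2 : k) • N) ∧ E * N - N * E = Y ∧
      ⨆ j : ℤ, Y.eigenspace (j : k) = ⊤ := by
  by_cases hN0 : N = 0
  · refine ⟨0, 0, by rw [mul_zero, sub_self, smul_zero], by rw [hN0, mul_zero, sub_self, smul_zero, neg_zero],
      by rw [hN0, mul_zero, sub_self], ?_⟩
    exact top_unique (le_iSup_of_le 0 (by rw [eigenspace_zero_intCast, if_pos rfl]))
  obtain ⟨Y, E, hY, hYE, hYN, hEN⟩ := exists_sl2Triple_of_isNilpotent' hN hN0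
  refine ⟨Y, E, hYE, hYN, hEN, ?_⟩
  letI : LieRing (Module.End k V) := LieRing.ofAssociativeRing
  letI : LieAlgebra k (Module.End k V) := LieAlgebra.ofAssociativeAlgebra
  have t : IsSl2Triple Y E N :=
    { h_ne_zero := hY
      lie_e_f := by rw [Ring.lie_def, hEN]
      lie_h_e_nsmul := by rw [Ring.lie_def, hYE, two_smul, two_nsmul]
      lie_h_f_nsmul := by rw [Ring.lie_def, hYN, two_smul, two_nsmul] }
  have h := IsSl2Triple.iSup_eigenspace_toEnd_h_intCast_eq_top (k := k) (M := V) t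
  have hY' : LieModule.toEnd k (Module.End k V) V Y = Y := LinearMap.ext fun _ => rfl
  rw [hY'] at h
  exact h

end Sl2

/-! ## §3 Proposition (1.6.9) (i): `M_i(V′ ⊗ V″) = Σ_{i′+i″=i} M_{i′}(V′) ⊗ M_{i″}(V″)` -/

section Tensor

variable {k : Type u} [Field k] [CharZero k] {V₁ : Type w} [AddCommGroup V₁] [Module k V₁] [FiniteDimensional k V₁]
  {V₂ : Type w'} [AddCommGroup V₂] [Module k V₂] [FiniteDimensional k V₂]

omit [CharZero k] [FiniteDimensional k V₁] [FiniteDimensional k V₂] in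
/-- Reindexing: `Σ_{i₁+i₂=n} (Σ_{a ≤ i₁−c₁} A_a) ⊗ (Σ_{b ≤ i₂−c₂} B_b) = Σ_{a+b ≤ n−c₁−c₂} A_a ⊗ B_b`. [folklore] -/
private theorem biSup_map₂_biSup_biSup_eq (A : ℤ → Submodule k V₁) (B : ℤ → Submodule k V₂) (c₁ c₂ n : ℤ) :
    ⨆ ij ∈ {ij : ℤ × ℤ | ij.1 + ij.2 = n}, Submodule.map₂ (TensorProduct.mk k V₁ V₂)
        (⨆ (a : ℤ) (_ : a ≤ ij.1 - c₁), A a) (⨆ (b : ℤ) (_ : b ≤ ij.2 - c₂), B b) =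
      ⨆ ab ∈ {ab : ℤ × ℤ | ab.1 + ab.2 ≤ n - (c₁ + c₂)},
        Submodule.map₂ (TensorProduct.mk k V₁ V₂) (A ab.1) (B ab.2) := by
  simp only [Submodule.map₂_iSup_left]
  simp only [Submodule.map₂_iSup_right]
  apply le_antisymm
  · refine iSup₂_le fun ij hij => iSup₂_le fun a ha => iSup₂_le fun b hb => ?_
    have hij' : ij.1 + ij.2 = n := hij
    exact le_iSup₂_of_le (f := fun (ab : ℤ × ℤ) (_ : ab ∈ {ab : ℤ × ℤ | ab.1 + ab.2 ≤ n - (c₁ + c₂)}) =>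
      Submodule.map₂ (TensorProduct.mk k V₁ V₂) (A ab.1) (B ab.2)) (a, b)
      (show a + b ≤ n - (c₁ + c₂) by omega) le_rfl
  · refine iSup₂_le fun ab hab => ?_
    have hab' : ab.1 + ab.2 ≤ n - (c₁ + c₂) := hab
    refine le_iSup₂_of_le (f := fun (ij : ℤ × ℤ) (_ : ij ∈ {ij : ℤ × ℤ | ij.1 + ij.2 = n}) =>
      ⨆ (a : ℤ) (_ : a ≤ ij.1 - c₁), ⨆ (b : ℤ) (_ : b ≤ ij.2 - c₂),
        Submodule.map₂ (TensorProduct.mk k V₁ V₂) (A a) (B b)) (ab.1 + c₁, n - (ab.1 + c₁))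
      (show ab.1 + c₁ + (n - (ab.1 + c₁)) = n by ring) ?_
    exact le_iSup₂_of_le ab.1 (by simp only; omega) (le_iSup₂_of_le ab.2 (by simp only; omega) le_rfl)

omit [CharZero k] [FiniteDimensional k V₁] [FiniteDimensional k V₂] in
/-- Reindexing: `Σ_{j ≤ m} Σ_{a+b=j} P_{a,b} = Σ_{a+b ≤ m} P_{a,b}`. [folklore] -/
private theorem biSup_biSup_fiber_add_eq {M : Type w} [AddCommGroup M] [Module k M] (P : ℤ × ℤ → Submodule k M)
    (m : ℤ) :
    ⨆ (j : ℤ) (_ : j ≤ m), ⨆ ab ∈ {ab : ℤ × ℤ | ab.1 + ab.2 = j}, P ab = ⨆ ab ∈ {ab : ℤ × ℤ | ab.1 + ab.2 ≤ m}, P ab :=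
  le_antisymm
    (iSup₂_le fun j hj => iSup₂_le fun ab (hab : ab.1 + ab.2 = j) =>
      le_iSup₂_of_le (f := fun (ab : ℤ × ℤ) (_ : ab ∈ {ab : ℤ × ℤ | ab.1 + ab.2 ≤ m}) => P ab) ab
        (show ab.1 + ab.2 ≤ m by omega) le_rfl)
    (iSup₂_le fun ab (hab : ab.1 + ab.2 ≤ m) =>
      le_iSup₂_of_le (f := fun (j : ℤ) (_ : j ≤ m) => ⨆ ab ∈ {ab : ℤ × ℤ | ab.1 + ab.2 = j}, P ab) (ab.1 + ab.2)
        hab (le_iSup₂_of_le ab rfl le_rfl))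

/-- **PROPOSITION (1.6.9) (i) (Deligne, Weil II): «Si `k` est de caractéristique `0`, la filtration `M` d'un produit
tensoriel est le produit tensoriel des filtrations `M` des facteurs (`M_i(V′⊗V″) = Σ_{i′+i″=i} M_{i′}(V′) ⊗
M_{i″}(V″))».** In the tree's language: if `W₁` is the monodromy weight filtration of `N₁` centred at `c₁` and `W₂`
that of `N₂` centred at `c₂` (finite-dimensional vector spaces over a field of characteristic `0`), then
`n ↦ Σ_{i+j=n} W₁ i ⊗ W₂ j` is the monodromy weight filtration of `N = N₁⊗1 + 1⊗N₂` centred at `c₁ + c₂`.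
Deligne's proof: (1.6.8) for Jacobson–Morozov triples through `N₁`, `N₂` and for their tensor product.
[cite: Deligne1980, Prop. (1.6.9) (i) with (1.6.8) (p0032)] -/
theorem IsMonodromyWeightFiltration.tensor {N₁ : Module.End k V₁} {N₂ : Module.End k V₂} {c₁ c₂ : ℤ}
    {W₁ : ℤ → Submodule k V₁} {W₂ : ℤ → Submodule k V₂} (hW₁ : IsMonodromyWeightFiltration N₁ c₁ W₁)
    (hW₂ : IsMonodromyWeightFiltration N₂ c₂ W₂) (hN₁ : IsNilpotent N₁) (hN₂ : IsNilpotent N₂) :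
    IsMonodromyWeightFiltration
      (TensorProduct.map N₁ (1 : Module.End k V₂) + TensorProduct.map (1 : Module.End k V₁) N₂) (c₁ + c₂)
      (fun n => ⨆ ij ∈ {ij : ℤ × ℤ | ij.1 + ij.2 = n},
        Submodule.map₂ (TensorProduct.mk k V₁ V₂) (W₁ ij.1) (W₂ ij.2)) := by
  obtain ⟨Y₁, E₁, hYE₁, hYN₁, hEN₁, hT₁⟩ := exists_sl2Triple_iSup_eigenspace_eq_top N₁ hN₁
  obtain ⟨Y₂, E₂, hYE₂, hYN₂, hEN₂, hT₂⟩ := exists_sl2Triple_iSup_eigenspace_eq_top N₂ hN₂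
  have h₁ : W₁ = fun i => ⨆ (j : ℤ) (_ : j ≤ i - c₁), Y₁.eigenspace (j : k) :=
    hW₁.unique (isMonodromyWeightFiltration_of_sl2' hYE₁ hYN₁ hEN₁ c₁)
  have h₂ : W₂ = fun i => ⨆ (j : ℤ) (_ : j ≤ i - c₂), Y₂.eigenspace (j : k) :=
    hW₂.unique (isMonodromyWeightFiltration_of_sl2' hYE₂ hYN₂ hEN₂ c₂)
  have hW := isMonodromyWeightFiltration_of_sl2' (kroneckerSum_sl2_he hYE₁ hYE₂) (kroneckerSum_sl2_hf hYN₁ hYN₂)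
    (kroneckerSum_sl2_ef hEN₁ hEN₂) (c₁ + c₂)
  have hfun : (fun n => ⨆ ij ∈ {ij : ℤ × ℤ | ij.1 + ij.2 = n},
      Submodule.map₂ (TensorProduct.mk k V₁ V₂) (W₁ ij.1) (W₂ ij.2)) =
      fun i => ⨆ (j : ℤ) (_ : j ≤ i - (c₁ + c₂)), Module.End.eigenspace
        (TensorProduct.map Y₁ (1 : Module.End k V₂) + TensorProduct.map (1 : Module.End k V₁) Y₂) (j : k) := by
    funext n
    rw [h₁, h₂]
    simp only
    rw [biSup_map₂_biSup_biSup_eq]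
    simp_rw [eigenspace_kroneckerSum_eq hT₁ hT₂]
    rw [biSup_biSup_fiber_add_eq]
  rw [hfun]
  exact hW

/-- **(1.6.9) (i), uniqueness form**: every monodromy weight filtration of `N₁⊗1 + 1⊗N₂` centred at `c₁ + c₂` is the
tensor product filtration `Σ_{i+j=n} W₁ i ⊗ W₂ j` of those of the factors. [cite: Deligne1980, Prop. (1.6.9) (i) (p0032)] -/
theorem IsMonodromyWeightFiltration.eq_tensor {N₁ : Module.End k V₁} {N₂ : Module.End k V₂} {c₁ c₂ : ℤ}
    {W₁ : ℤ → Submodule k V₁} {W₂ : ℤ → Submodule k V₂} {W : ℤ → Submodule k (TensorProduct k V₁ V₂)}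
    (hW : IsMonodromyWeightFiltration
      (TensorProduct.map N₁ (1 : Module.End k V₂) + TensorProduct.map (1 : Module.End k V₁) N₂) (c₁ + c₂) W)
    (hW₁ : IsMonodromyWeightFiltration N₁ c₁ W₁) (hW₂ : IsMonodromyWeightFiltration N₂ c₂ W₂)
    (hN₁ : IsNilpotent N₁) (hN₂ : IsNilpotent N₂) :
    W = fun n => ⨆ ij ∈ {ij : ℤ × ℤ | ij.1 + ij.2 = n},
      Submodule.map₂ (TensorProduct.mk k V₁ V₂) (W₁ ij.1) (W₂ ij.2) :=
  hW.unique (hW₁.tensor hW₂ hN₁ hN₂)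

/-- **(1.6.9) (i) for the tree's definition**: `W(N₁⊗1+1⊗N₂)[−(c₁+c₂)]_n = Σ_{i+j=n} W(N₁)[−c₁]_i ⊗ W(N₂)[−c₂]_j`.
[cite: Deligne1980, Prop. (1.6.9) (i) (p0032)] -/
theorem monodromyWeightFiltration_kroneckerSum {N₁ : Module.End k V₁} {N₂ : Module.End k V₂}
    (hN₁ : IsNilpotent N₁) (hN₂ : IsNilpotent N₂) (c₁ c₂ : ℤ) :
    monodromyWeightFiltration
        (TensorProduct.map N₁ (1 : Module.End k V₂) + TensorProduct.map (1 : Module.End k V₁) N₂)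
        (isNilpotent_kroneckerSum hN₁ hN₂) (c₁ + c₂) =
      fun n => ⨆ ij ∈ {ij : ℤ × ℤ | ij.1 + ij.2 = n}, Submodule.map₂ (TensorProduct.mk k V₁ V₂)
        (monodromyWeightFiltration N₁ hN₁ c₁ ij.1) (monodromyWeightFiltration N₂ hN₂ c₂ ij.2) :=
  (isMonodromyWeightFiltration_monodromyWeightFiltration _ _ _).eq_tensor
    (isMonodromyWeightFiltration_monodromyWeightFiltration N₁ hN₁ c₁)
    (isMonodromyWeightFiltration_monodromyWeightFiltration N₂ hN₂ c₂) hN₁ hN₂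

end Tensor

end Literature.AlgebraicGeometry.HodgeTheory
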